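import Summits.QuantumFields.BalabanUV.T4Continuum.Support.NE7HintOfLocalChart
import Summits.QuantumFields.BalabanUV.T4Continuum.Support.NE7OneStepOfRoutePi
import HarnessLib

/-!
# NE7 — (8)∃ from the local chart for SU(2)∕U(2) on T⁴ with `L = 2` (F286)

[Balaban1985Variational] Thm 1 (8) ∘ Prop 8 ∘ [Balaban1983Laplace] Thm 2, row NE7, at `d = 4`, `L = 2`,
`card n = 2`, `ε ≤ 10⁻⁵³`: F285 `NE7HintOfLocalChart.hint_of_localChart` with the multi-level class
smallness (`NE7ConvOneStepSU2.levelSmall_all_d4_L2`) and the slice Poincaré inequality on the class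
(`NE3ClassRadiusFamily.classSlicePoincare_SU2'`, constant `CPLine 4 2 2 10⁻¹⁷ 10⁻⁵³ + 1`) DISCHARGED, as in
F31's `NE7OneStepOfRoutePi.oneStep_SU2_of_dataClass_ape_routePi`.  What the bill still asserts for
nothing: THE CHART ([B8] Thm 2 at `U₀ = 1` on nested cubes of radius `(nbRad 4 2 + 2ℓ + 10)·2^(k+1)`,
constants `≤ A(ℓ+1)^p`, small field `r ≤ ε/4`), row NE3's `hleaves` ([B11] Prop 2 TYPE, at
`δ₁ = ε/8`), and route Π's two `k`-free numeric lines in the letters `(C₂, αh, Ch, νh, κh)`.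
Conclusion: (8)∃ — the `hint` binder of route 1's END
`NE7Route1EndDockedInterior.goodClause_summable_of_route1_docked_interior` — over the small data
`{V | unitary, N-periodic, SmallField V δ_V}`.  NE7 is NOT proved unconditionally; nothing of Bałaban's
is asserted as an axiom.
-/

open scoped BigOperators Matrix Matrix.Norms.L2Operator Topology
open NormedSpace Finset Set Filter

namespace Summit.QuantumFields.BalabanUV.T4Continuum.NE7HintOfLocalChartSU2

open Literature.MathematicalPhysics.QuantumFieldTheory.Balaban1983to89
open B7Prop1Explicit B7Prop2Explicit MatrixLog UnitaryModel
open B4TorusKernel.MultiPeriod (torusSupNorm)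
open T4AveragingDeficitWall (IsUnitaryCfg IsSkewDir SmallField vary curl curlSq dirSq dirL1)
open T4AveragingDeficitWallBoundary (IsPeriodicCfg periodBox)
open AveragingDeficitPeriodicCounting (IsPeriodicDir)
open AveragingDeficitMultiLevelPrep (LevelSmall tower TangentIter)
open BlockAverageVaryHolo (nbRad)
open MinimalActionLevels (perWin)
open MinimalActionSandwich (IsMinimiser admissible)
open MinimalActionRate (sfClass)
open NE3HessForm (dAction)
open NE3SlicePoincareShape (SlicePoincare slicePoincare_mono)
open NE3SlicePoincareBudgetLine (CPLine)
open NE3ClassRadiusFamily (classSlicePoincare_SU2' CPLine_nonneg_d4_L2)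
open NE3FrameFreeSliceW (frameFreeBlockLandauW)
open NE3TangentCovariantTower (dirIter)
open NE3DecomposedRepOfLinearNormalPart (ResidualSliceRepT)
open NE3QbarIterCovLiftPrep (cruxC)
open NE3SmoothRightInverseW (rightInvW)
open NE3RightInverseSolveLetters (thetaLoc)
open NE3RightInverseL2Letter (l2C)
open NE3HatInvCurlLetters (curl2C curl1C)
open NE3EnergyShapes (IsUnitarySite)
open BlockAveragePushDirSplit (flat)
open NE7ConvOneStepSU2 (levelSmall_all_d4_L2)
open NE7HintOfLocalChart (hint_of_localChart)

variable {n : Type*} [Fintype n] [DecidableEq n]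

set_option maxHeartbeats 400000 in
/-- **F286 — (8)∃ from the local chart, SU(2)∕U(2) on T⁴, `L = 2`.**  [Balaban1985Variational] Thm 1 (8) ∘
Prop 8 ∘ [Balaban1983Laplace] Thm 2, rows NE7 ∘ NE3, `card n = 2`: for every polynomial growth law
`A·(ℓ+1)^p` of the chart constants there are `ℓ ≥ 1`, `ε₀ > 0` (`ε₀ ≤ 10⁻⁵³`) and, for every
`0 < ε ≤ ε₀`, a `β₀ > 0` such that for `0 < β ≤ β₀` and every period `N ≥ 1`: IF route Π's two `k`-free
lines (letters `C₂, αh, Ch, νh, κh`), THE LOCAL CHART on the `(4ℓ+12)`-fold cover (constants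
`≤ A(ℓ+1)^p`, small field `r ≤ ε/4`) and row NE3's `hleaves` (at `δ₁ = ε/8`) hold, THEN for some
`δ_V > 0`, over `{V | unitary, N-periodic, SmallField V δ_V}`, at every level some constrained minimiser
over `sfClass 4 2 N ε` is `SmallField U a` with `0 ≤ a < ε/(2^k)²`. -/
theorem hint_of_localChart_SU2 [Nonempty n] (hn : Fintype.card n = 2) {A : ℝ} (hA : 0 ≤ A) (p : ℕ) :
    ∃ ℓ : ℕ, 1 ≤ ℓ ∧ ∃ ε₀ : ℝ, 0 < ε₀ ∧ ∀ ε : ℝ, 0 < ε → ε ≤ ε₀ → ∃ β₀ : ℝ, 0 < β₀ ∧ ∀ β : ℝ, 0 < β → β ≤ β₀ →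
    ∀ (N : ℕ) [NeZero N] (C₀ C₁ C₂ αh Ch νh κh : ℝ), 1 ≤ N →
    0 ≤ C₂ → 0 ≤ αh → αh ≤ 1 → 0 ≤ Ch →
    νh = 2 * Real.sqrt (l2C 4 2 / (1 - thetaLoc 4 2 * ε) ^ 2 + curl2C 4 2 / (1 - thetaLoc 4 2 * ε) ^ 2) * C₂ * Ch * αh →
    κh = 4 * (curl1C 4 2 / (1 - thetaLoc 4 2 * ε)) * C₂ * Ch ^ 2 * ε →
    νh < 1 →
    2 * (κh / (1 - νh) ^ 2) < ((((1 / 2 - (νh / (1 - νh)) ^ 2) / (2 * (1 + (CPLine 4 2 2 (1 / 10 ^ 17) (1 / 10 ^ 53) + 1))) - (νh / (1 - νh)) ^ 2) / 2 - 576 * ((4 : ℕ) : ℝ) * (αh ^ 2 * Real.exp (2 * αh))) / (Fintype.card n : ℝ) - 28 * ((4 : ℕ) : ℝ) * (ε + 7 * αh ^ 2)) →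
    0 ≤ C₀ → C₀ ≤ A * ((ℓ : ℝ) + 1) ^ p → 0 ≤ C₁ → C₁ ≤ A * ((ℓ : ℝ) + 1) ^ p →
    (∀ D : Site 4 → Fin 4 → (Matrix n n ℂ)ˣ, IsUnitaryCfg D → IsPeriodicCfg D ((N * (4 * ℓ + 12)) : ℤ) → SmallField D (4 * (Real.exp β - 1)) →
      ∀ (k : ℕ), ∀ U ∈ admissible (sfClass 4 2 (N * (4 * ℓ + 12)) ε) 2 (k + 1) D,
      (∀ φ : Site 4 → Fin 4 → Matrix n n ℂ, IsSkewDir φ → IsPeriodicDir φ (((N * (4 * ℓ + 12)) * 2 ^ (k + 1) : ℕ) : ℤ) → TangentIter 2 k U φ →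
        dAction U φ (perWin 4 ((N * (4 * ℓ + 12)) * 2 ^ (k + 1))) = 0) →
      ∀ r : ℝ, 0 ≤ r → r ≤ (1 / ((2 : ℕ) : ℝ) ^ 2 * ε) → SmallField U (r / (((2 : ℕ) : ℝ) ^ (k + 1)) ^ 2) →
      ∀ z : Site 4, ∃ (u : Site 4 → (Matrix n n ℂ)ˣ) (At : Site 4 → Fin 4 → Matrix n n ℂ) (a₀ a₁ : ℝ),
        IsUnitarySite u ∧ (∀ (y : Site 4) (i : Fin 4), u (y + (((N * (4 * ℓ + 12)) * 2 ^ (k + 1) : ℕ) : ℤ) • e i) = u y) ∧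
        IsSkewDir At ∧ IsPeriodicDir At (((N * (4 * ℓ + 12)) * 2 ^ (k + 1) : ℕ) : ℤ) ∧ 0 ≤ a₀ ∧ 0 ≤ a₁ ∧
        (∀ (y : Site 4) (κ : Fin 4), ‖At y κ‖ ≤ a₀) ∧ (∀ (y : Site 4) (κ τ : Fin 4), ‖At (y + e τ) κ - At y κ‖ ≤ a₁) ∧
        ((2 : ℕ) : ℝ) ^ (k + 1) * a₀ ≤ C₀ * (r + 4 * (Real.exp β - 1) + ε) ∧ (((2 : ℕ) : ℝ) ^ (k + 1)) ^ 2 * a₁ ≤ C₁ * (r + 4 * (Real.exp β - 1) + ε) ∧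
        (∀ (y : Site 4) (κ : Fin 4),
          torusSupNorm (fun _ : Fin 4 => 2 ^ (k + 1) * (N * (4 * ℓ + 12))) (y - z) ≤ (((nbRad 4 2 + 2 * ℓ + 10) * 2 ^ (k + 1) : ℕ) : ℝ) →
            gaugeAct u U y κ = vary (flat (d := 4) (n := n)) At 1 y κ)) →
    (∀ D : Site 4 → Fin 4 → (Matrix n n ℂ)ˣ, IsUnitaryCfg D → IsPeriodicCfg D (N : ℤ) → SmallField D (4 * (Real.exp β - 1)) → ∀ (k : ℕ), ∀ Us ∈ admissible (sfClass 4 2 N ε) 2 (k + 1) D, SmallField Us ((1 / ((2 : ℕ) : ℝ) ^ 2 * ε / 2) / (((2 : ℕ) : ℝ) ^ (k + 1)) ^ 2) → (∀ φ : Site 4 → Fin 4 → Matrix n n ℂ, IsSkewDir φ → IsPeriodicDir φ ((N * 2 ^ (k + 1) : ℕ) : ℤ) → TangentIter 2 k Us φ → dAction Us φ (perWin 4 (N * 2 ^ (k + 1))) = 0) → ∀ U' ∈ admissible (sfClass 4 2 N ε) 2 (k + 1) D, ∃ (u : Site 4 → (Matrix n n ℂ)ˣ) (X₀ : Site 4 →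 Fin 4 → Matrix n n ℂ) (α₀ : ℝ) (m : Site 4 → Fin 4 → ℝ) (C : ℝ), IsSkewDir X₀ ∧ (∀ (hWu : IsUnitaryCfg Us) (hx : 0 ≤ ε / (((2 : ℕ) : ℝ) ^ (k + 1)) ^ 2) (hs : LevelSmall 4 2 k (ε / (((2 : ℕ) : ℝ) ^ (k + 1)) ^ 2)) (hWx : SmallField Us (ε / (((2 : ℕ) : ℝ) ^ (k + 1)) ^ 2)) (hθ : cruxC 4 2 * ((((2 : ℕ) : ℝ) ^ (k + 1)) ^ 2 * (ε / (((2 : ℕ) : ℝ) ^ (k + 1)) ^ 2)) < 1) (hφ : IsSkewDir (dirIter 2 (k + 1) Us X₀)), ResidualSliceRepT 2 N (k + 1) Us U' u X₀ (rightInvW (by norm_num) k hWu hx hs hWx N hθ hφ) α₀) ∧ (∀ z κ, 0 ≤ m z κ) ∧ 0 ≤ C ∧ (((2 : ℕ) : ℝ) ^ (k + 1)) ^ 4 * ∑ z ∈ periodBox (d := 4) N, ∑ κ : Fin 4, m z κ ^ 2 ≤ C ^ 2 * dirSq X₀ (periodBox (d := 4) (N * 2 ^ (k + 1))) ∧ (∀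 z ∈ periodBox (d := 4) N, ∀ κ : Fin 4, ‖dirIter 2 (k + 1) Us X₀ z κ‖ ≤ C₂ * (((2 : ℕ) : ℝ) ^ (k + 1) * m z κ) ^ 2) ∧ α₀ * ((2 : ℕ) : ℝ) ^ (k + 1) ≤ αh ∧ (∀ z κ, m z κ * ((2 : ℕ) : ℝ) ^ (k + 1) ≤ αh) ∧ C ≤ Ch) →
    ∃ δV : ℝ, 0 < δV ∧
      ∀ V ∈ {V : Site 4 → Fin 4 → (Matrix n n ℂ)ˣ | IsUnitaryCfg V ∧ IsPeriodicCfg V (N : ℤ) ∧ SmallField V δV},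
      ∀ k : ℕ, ∃ U : Site 4 → Fin 4 → (Matrix n n ℂ)ˣ, IsMinimiser 4 (sfClass 4 2 N ε) 2 N k V U ∧
        ∃ a : ℝ, 0 ≤ a ∧ a < ε / (((2 : ℕ) : ℝ) ^ k) ^ 2 ∧ SmallField U a := by
  obtain ⟨ℓ, hℓ1, ε₀, hε₀, H⟩ := hint_of_localChart (d := 3) (n := n) (L := 2) (by norm_num) hA p
  refine ⟨ℓ, hℓ1, min ε₀ (1 / 10 ^ 53), lt_min hε₀ (by norm_num), fun ε hε hεle => ?_⟩
  obtain ⟨β₀, hβ₀, H2⟩ := H ε hε (hεle.trans (min_le_left _ _))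
  refine ⟨β₀, hβ₀, ?_⟩
  intro β hβ hβle N _ C₀ C₁ C₂ αh Ch νh κh hN hC₂ hαh0 hαh1 hCh0 hνh hκh hν hline hC₀ hC₀b hC₁ hC₁b hchart hleaves
  have hε' : ε ≤ 1 / 10 ^ 53 := hεle.trans (min_le_right _ _)
  have hP0 := classSlicePoincare_SU2' (n := n) hn hN hε hε'
  have hCP : 0 < CPLine 4 2 2 (1 / 10 ^ 17) (1 / 10 ^ 53) + 1 := by linarith [CPLine_nonneg_d4_L2]
  have hP : ∀ (j : ℕ) (W : Site 4 → Fin 4 → (Matrix n n ℂ)ˣ), W ∈ sfClass 4 2 N ε (j + 1) →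
      SlicePoincare 2 (j + 1) W (frameFreeBlockLandauW 2 N (j + 1) W) (CPLine 4 2 2 (1 / 10 ^ 17) (1 / 10 ^ 53) + 1)
        (periodBox (d := 4) (N * 2 ^ (j + 1))) :=
    fun j W hW => slicePoincare_mono (hP0 j W hW) (by linarith)
  have hls := levelSmall_all_d4_L2 hε.le (hε'.trans (by norm_num))
  exact H2 β hβ hβle N (CPLine 4 2 2 (1 / 10 ^ 17) (1 / 10 ^ 53) + 1) C₀ C₁ C₂ αh Ch νh κh hN hCP hls hP hC₂ hαh0 hαh1
    hCh0 hνh hκh hν hline hC₀ hC₀b hC₁ hC₁b hchart hleaves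

end Summit.QuantumFields.BalabanUV.T4Continuum.NE7HintOfLocalChartSU2
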